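import Literature.NumberTheory.Sieve.MontgomeryVaughan1975PointwiseLowerBound
import Literature.NumberTheory.Sieve.MontgomeryVaughan1975LevelSelection
import Literature.NumberTheory.Sieve.MontgomeryVaughan1975FormulaeAtSmall
import Literature.NumberTheory.Sieve.MontgomeryVaughan1975ExceptionalConductors
import HarnessLib

/-!
# Pointwise major arcs with the exceptional prime built in (the major-arc input of Gallagher's
proof of Linnik's theorem), from Montgomery–Vaughan 1975 — PROVED

Topic `Literature/NumberTheory/Sieve`, namespace `Literature.NumberTheory.Sieve.GoldbachLinnik`
(continuation of `MontgomeryVaughan1975PointwiseLowerBound.lean`, `…LevelSelection.lean`,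
`…FormulaeAtSmall.lean`, `…ExceptionalConductors.lean`, `GoldbachLinnikMVMajorArcBridge.lean`,
`GoldbachLinnikDirectMinorArcs.lean`).

Gallagher's proof of Linnik's theorem [Gallagher1975, Theorem 1, §§3–4] (every large even `N` is
`p + q +` at most `K` powers of two, for SOME `K`) takes from the major arcs, for EVERY even
`n ∈ [N/2, N]`, a lower bound `R_𝔐(n) ≥ c₀𝔖(n)n − κ𝔖(n)N` except when a large «exceptional prime»
divides `n`, where it still has `R_𝔐(n) ≥ −κ𝔖(n)N`, together with a power-saving sup bound for
the prime exponential sum off the arcs.  This file assembles exactly that statement — VERBATIM the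
crux `PointwiseMajorArcsMV` of the parity-ideate route `LinnikGallagherMV` (item stmt-Parity-20512)
— from the tree's PROVED analysis of Montgomery–Vaughan 1975 [MontgomeryVaughanActa1975, §§4–8]:
the major-arc formulae at every small Page constant (`majorArc_formulae_forall_small`), Page's
theorem across the three levels `a ∈ {δ/4, 2δ/3, δ}` (`levelSelection`), `r̃ → ∞` with the level
(`exceptionalConductor_unbounded`), the pointwise §8 (`pointwise_lowerBound_of_formulae`), the
bridge to Heath-Brown–Puchta's `A_N` (`abs_majorArcGoldbachIntegral_periodicArcs_sub_re_le'`) and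
Vinogradov's bound off the periodised arcs (`norm_oddPrimeLogSum_le_of_not_mem_periodicArcs`).
Constants: `c₀ = 2/3`, `θ = δ/2`, `δ = δ(κ)` with `C(1 + c₁)e^{−c₆/δ} ≤ κC₂/4`, `δ ≤ min(δ₀, 1/24)`;
the arcs are `𝔐_N = periodicArcs (N^{6a(N)}) (N^{1−6a(N)})` at the selected level, and `p_N` is
the largest prime `> 3` of the exceptional conductor at that level (`0` if there is none).  No new
facts.  Written for the parity-ideate cell (literature seat g16, 2026-08-27).

* `eventually_level_thresholds`, `eventually_minorArc_level`, `eventually_conductor_gt_level` —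
  the «`X ≥ X₀(δ)`» inequalities at a fixed level `a`.
* `exists_excPrime` — the exceptional prime at a level, with its specification.
* `eventually_pointwise_level` — the per-level package (minor arcs, `Lemma41At`, pointwise bounds
  given the level-selection property).
* `pointwiseMajorArcsMV` — the crux, verbatim.

## References

* [Gallagher1975] P. X. Gallagher, *Primes and powers of 2*, Invent. Math. 29 (1975) 125–142,
  Theorem 1, §§3–4.
* [MontgomeryVaughanActa1975] H. L. Montgomery, R. C. Vaughan, *The exceptional set in Goldbach's
  problem*, Acta Arith. 27 (1975) 353–370, §§4–8.
* [HeathbrownPuchta2002] D. R. Heath-Brown, J.-C. Puchta, *Integers represented as a sum of primes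
  and powers of two*, Asian J. Math. 6 (2002) 535–565, §4 (16)–(25), §6.

## Mathlib / tree search

Tree: all inputs listed above; `periodicArcs`, `measurableSet_periodicArcs`, `oddPrimeLogSum`,
`majorArcGoldbachIntegral`, `goldbachSingularSeries`, `twinPrimeConst`, `half_le_twinPrimeConst`,
`dvd_mul_prod_primeFactors_of_isPrimitive`. Mathlib: `tendsto_rpow_neg_atTop`,
`isLittleO_log_rpow_rpow_atTop`, `tendsto_natCast_atTop_atTop`, `primorial`.
`lean search 'pointwiseMajorArcsMV|exists_excPrime|eventually_pointwise_level'`: nothing before this file.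
-/

noncomputable section

open scoped FourierTransform

open Finset Filter MeasureTheory Topology

namespace Literature.NumberTheory.Sieve

namespace GoldbachLinnik

open MontgomeryVaughan1975

/-! ### The thresholds «`δ` small, `X ≥ X₀(δ)`» at a fixed level `a` -/

/-- Exponent bookkeeping at level `P = X^{6a}`: `X^{1+a}P⁻¹ = X·X^{−5a}`,
`X^{1+a}P⁻¹P^{2/3} = X·X^{−a}`, `P²X/X^{1−6a} = X·X^{−(1−18a)}`. [folklore] -/
private theorem level_rpow_identities {X a : ℝ} (hX : 0 < X) :
    X ^ (1 + a) * (X ^ (6 * a))⁻¹ = X * X ^ (-(5 * a)) ∧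
    X ^ (1 + a) * (X ^ (6 * a))⁻¹ * (X ^ (6 * a)) ^ (2 / 3 : ℝ) = X * X ^ (-a) ∧
    (X ^ (6 * a)) ^ 2 * X / X ^ (1 - 6 * a) = X * X ^ (-(1 - 18 * a)) := by
  have h1 : X ^ (1 + a) * (X ^ (6 * a))⁻¹ = X * X ^ (-(5 * a)) := by
    rw [← Real.rpow_neg hX.le, ← Real.rpow_add hX, show (1 + a + -(6 * a)) = 1 + -(5 * a) by ring,
      Real.rpow_add hX, Real.rpow_one]
  refine ⟨h1, ?_, ?_⟩
  · rw [h1, ← Real.rpow_mul hX.le, mul_assoc, ← Real.rpow_add hX]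
    congr 1; ring_nf
  · have e1 : (X ^ (6 * a)) ^ 2 = X ^ (12 * a) := by
      rw [sq, ← Real.rpow_add hX]; ring_nf
    rw [e1, div_eq_mul_inv, ← Real.rpow_neg hX.le,
      show X ^ (12 * a) * X * X ^ (-(1 - 6 * a)) = X * (X ^ (12 * a) * X ^ (-(1 - 6 * a))) by ring,
      ← Real.rpow_add hX, show (12 * a + -(1 - 6 * a)) = -(1 - 18 * a) by ring]

/-- **The thresholds at level `a`** (Montgomery–Vaughan's «`δ` sufficiently small, `X > X₀(δ)`»,
§8), eventually in real `X`: `2 ≤ P`, `P + 1 < Q`, `c₁ < log P`, `C X^{1+a}P⁻¹ ≤ κX/4`,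
`C X^{1+a}P⁻¹P^{2/3} ≤ κX/4`, `48 P²X/Q ≤ κX/4`, for `P = X^{6a}`, `Q = X^{1−6a}`, `0 < a < 1/18`.
[cite: MontgomeryVaughanActa1975, §8 (8.3)] -/
theorem eventually_level_thresholds {a C κ : ℝ} (c₁ : ℝ) (ha : 0 < a) (ha18 : a < 1 / 18)
    (hC : 0 < C) (hκ : 0 < κ) :
    ∀ᶠ X : ℝ in atTop, 2 ≤ X ^ (6 * a) ∧ X ^ (6 * a) + 1 < X ^ (1 - 6 * a) ∧
      c₁ < Real.log (X ^ (6 * a)) ∧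
      C * (X ^ (1 + a) * (X ^ (6 * a))⁻¹) ≤ κ / 4 * X ∧
      C * (X ^ (1 + a) * (X ^ (6 * a))⁻¹ * (X ^ (6 * a)) ^ (2 / 3 : ℝ)) ≤ κ / 4 * X ∧
      48 * (X ^ (6 * a)) ^ 2 * X / X ^ (1 - 6 * a) ≤ κ / 4 * X := by
  have hP : Tendsto (fun X : ℝ => X ^ (6 * a)) atTop atTop := tendsto_rpow_atTop (by linarith)
  -- (1) `2 ≤ P`
  have e1 : ∀ᶠ X : ℝ in atTop, 2 ≤ X ^ (6 * a) := hP.eventually_ge_atTop 2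
  -- (2) `P + 1 < Q`: `2P < P · X^{1-12a}` once `2 < X^{1-12a}`
  have e2 : ∀ᶠ X : ℝ in atTop, X ^ (6 * a) + 1 < X ^ (1 - 6 * a) := by
    have h := (tendsto_rpow_atTop (by linarith : 0 < 1 - 12 * a)).eventually_gt_atTop 2
    filter_upwards [h, e1, eventually_gt_atTop 0] with X hX hP2 hX0
    have heq : X ^ (1 - 6 * a) = X ^ (6 * a) * X ^ (1 - 12 * a) := by
      rw [← Real.rpow_add hX0]; ring_nf
    rw [heq]
    have hP0 : 0 < X ^ (6 * a) := by linarith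
    nlinarith
  -- (3) `c₁ < log P`
  have e3 : ∀ᶠ X : ℝ in atTop, c₁ < Real.log (X ^ (6 * a)) :=
    (Real.tendsto_log_atTop.comp hP).eventually_gt_atTop c₁
  -- (4)–(6): `C X^{-5a}`, `C X^{-a}`, `48 X^{-(1-18a)}` are eventually `≤ κ/4`
  have small : ∀ {b K : ℝ}, 0 < b → 0 < K → ∀ᶠ X : ℝ in atTop, K * X ^ (-b) ≤ κ / 4 := by
    intro b K hb hK
    have h : Tendsto (fun X : ℝ => K * X ^ (-b)) atTop (𝓝 (K * 0)) :=
      (tendsto_rpow_neg_atTop hb).const_mul K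
    rw [mul_zero] at h
    exact h.eventually (ge_mem_nhds (by positivity))
  have e4 := small (b := 5 * a) (K := C) (by linarith) hC
  have e5 := small (b := a) (K := C) ha hC
  have e6 := small (b := 1 - 18 * a) (K := 48) (by linarith) (by norm_num)
  filter_upwards [e1, e2, e3, e4, e5, e6, eventually_gt_atTop 0] with X h1 h2 h3 h4 h5 h6 hX0
  obtain ⟨i1, i2, i3⟩ := level_rpow_identities (a := a) hX0
  refine ⟨h1, h2, h3, ?_, ?_, ?_⟩
  · rw [i1, show C * (X * X ^ (-(5 * a))) = (C * X ^ (-(5 * a))) * X by ring]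
    exact mul_le_mul_of_nonneg_right h4 hX0.le
  · rw [i2, show C * (X * X ^ (-a)) = (C * X ^ (-a)) * X by ring]
    exact mul_le_mul_of_nonneg_right h5 hX0.le
  · rw [show 48 * (X ^ (6 * a)) ^ 2 * X / X ^ (1 - 6 * a) =
        48 * ((X ^ (6 * a)) ^ 2 * X / X ^ (1 - 6 * a)) by ring, i3,
      show 48 * (X * X ^ (-(1 - 18 * a))) = (48 * X ^ (-(1 - 18 * a))) * X by ring]
    exact mul_le_mul_of_nonneg_right h6 hX0.le

/-- **Exceptional conductors at level `X^{6a}` are eventually larger than any `R`**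
(`exceptionalConductor_unbounded` along `P = X^{6a} → ∞`). [cite: MontgomeryVaughanActa1975, §8 (8.4)] -/
theorem eventually_conductor_gt_level {c₁ a : ℝ} (hc₁ : 0 < c₁) (ha : 0 < a) (R : ℕ) :
    ∀ᶠ X : ℝ in atTop, ∀ (r : ℕ) [NeZero r] (χ : DirichletCharacter ℂ r) (β : ℝ),
      IsExceptionalZero c₁ (X ^ (6 * a)) r χ β → R < r := by
  obtain ⟨P₀, hP₀⟩ := exceptionalConductor_unbounded c₁ hc₁ R
  have hP : Tendsto (fun X : ℝ => X ^ (6 * a)) atTop atTop := tendsto_rpow_atTop (by linarith)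
  filter_upwards [hP.eventually_ge_atTop P₀] with X hX r _ χ β h
  exact hP₀ _ hX r χ β h

/-- **Vinogradov off the periodised arcs at level `a`, with a clean power saving**: for
`0 < δ ≤ 1/24` and `δ/4 ≤ a ≤ δ`, eventually in `N`,
`‖A_N(α)‖ ≤ N^{1−δ/2}` for `α ∈ [0,1] ∖ periodicArcs (N^{6a}) (N^{1−6a})`
(`norm_oddPrimeLogSum_le_of_not_mem_periodicArcs`: `C(N/√P + N^{4/5} + √N√Q) log⁴N` with
`N/√P = √N√Q = N^{1−3a} ≤ N^{1−3δ/4}` and `log⁴ N ≤ N^{δ/8}`).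
[cite: MontgomeryVaughanActa1975, §3 (3.3); HeathbrownPuchta2002, §4 (25)] -/
theorem eventually_minorArc_level {δ a : ℝ} (hδ : 0 < δ) (hδ24 : δ ≤ 1 / 24) (ha : δ / 4 ≤ a)
    (haδ : a ≤ δ) :
    ∀ᶠ N : ℕ in atTop, ∀ α ∈ Set.Icc (0 : ℝ) 1 \ periodicArcs ((N : ℝ) ^ (6 * a)) ((N : ℝ) ^ (1 - 6 * a)),
      ‖oddPrimeLogSum N α‖ ≤ (N : ℝ) ^ (1 - δ / 2) := by
  obtain ⟨C, hC0, hC⟩ := norm_oddPrimeLogSum_le_of_not_mem_periodicArcs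
  have ha0 : 0 < a := by linarith
  have ha18 : a < 1 / 18 := by linarith
  -- real-variable thresholds
  have hlog : ∀ᶠ X : ℝ in atTop, Real.log X ^ 4 ≤ X ^ (δ / 8) := by
    have h := (isLittleO_log_rpow_rpow_atTop (4 : ℝ) (by positivity : 0 < δ / 8)).bound
      (by norm_num : (0 : ℝ) < 1)
    filter_upwards [h, eventually_ge_atTop (1 : ℝ)] with X hX hX1
    have hl0 : 0 ≤ Real.log X := Real.log_nonneg hX1
    rw [one_mul, Real.norm_of_nonneg (Real.rpow_nonneg hl0 _),
      Real.norm_of_nonneg (Real.rpow_nonneg (by linarith) _)] at hX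
    calc Real.log X ^ 4 = Real.log X ^ ((4 : ℕ) : ℝ) := (Real.rpow_natCast _ 4).symm
      _ = Real.log X ^ (4 : ℝ) := by norm_num
      _ ≤ X ^ (δ / 8) := hX
  have hconst : ∀ᶠ X : ℝ in atTop, 3 * C + 1 ≤ X ^ (δ / 8) :=
    (tendsto_rpow_atTop (by positivity)).eventually_ge_atTop _
  have hthr := eventually_level_thresholds (C := 1) (κ := 1) 0 ha0 ha18 one_pos one_pos
  have hev : ∀ᶠ X : ℝ in atTop, 3 ≤ X ∧ Real.log X ^ 4 ≤ X ^ (δ / 8) ∧ 3 * C + 1 ≤ X ^ (δ / 8) ∧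
      2 ≤ X ^ (6 * a) ∧ X ^ (6 * a) + 1 < X ^ (1 - 6 * a) := by
    filter_upwards [eventually_ge_atTop (3 : ℝ), hlog, hconst, hthr] with X h1 h2 h3 h4
    exact ⟨h1, h2, h3, h4.1, h4.2.1⟩
  filter_upwards [hev.natCast_atTop] with N hN α hα
  obtain ⟨hN3, hlogN, hCN, hP2, hPQ⟩ := hN
  have hN3' : 3 ≤ N := by exact_mod_cast hN3
  have hN0 : (0 : ℝ) < N := by linarith
  have hN1 : (1 : ℝ) ≤ N := by linarith
  set X : ℝ := (N : ℝ) with hXdef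
  have hQN : X ^ (1 - 6 * a) ≤ X := by
    calc X ^ (1 - 6 * a) ≤ X ^ (1 : ℝ) := Real.rpow_le_rpow_of_exponent_le hN1 (by linarith)
      _ = X := Real.rpow_one X
  have h := hC N hN3' (X ^ (6 * a)) (X ^ (1 - 6 * a)) (by linarith) hPQ.le hQN α hα
  -- `N/√P = √N √Q = N^{1-3a}`
  have hsqrtP : Real.sqrt (X ^ (6 * a)) = X ^ (3 * a) := by
    rw [Real.sqrt_eq_rpow, ← Real.rpow_mul hN0.le]; ring_nf
  have h1 : X / Real.sqrt (X ^ (6 * a)) = X ^ (1 - 3 * a) := by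
    rw [hsqrtP, div_eq_mul_inv, ← Real.rpow_neg hN0.le, ← Real.rpow_one_add' hN0.le (by linarith)]
    ring_nf
  have h2 : Real.sqrt X * Real.sqrt (X ^ (1 - 6 * a)) = X ^ (1 - 3 * a) := by
    rw [Real.sqrt_eq_rpow, Real.sqrt_eq_rpow, ← Real.rpow_mul hN0.le, ← Real.rpow_add hN0]
    ring_nf
  rw [h1, h2] at h
  -- exponent comparisons
  have hA : X ^ (1 - 3 * a) * X ^ (δ / 8) ≤ X ^ (1 - 5 * δ / 8) := by
    rw [← Real.rpow_add hN0]
    exact Real.rpow_le_rpow_of_exponent_le hN1 (by linarith)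
  have hB : X ^ (4 / 5 : ℝ) * X ^ (δ / 8) ≤ X ^ (1 - 5 * δ / 8) := by
    rw [← Real.rpow_add hN0]
    exact Real.rpow_le_rpow_of_exponent_le hN1 (by linarith)
  have hsplit : X ^ (1 - δ / 2) = X ^ (1 - 5 * δ / 8) * X ^ (δ / 8) := by
    rw [← Real.rpow_add hN0]; ring_nf
  have hY0 : 0 ≤ X ^ (1 - 5 * δ / 8) := Real.rpow_nonneg hN0.le _
  have hlog0 : 0 ≤ Real.log X ^ 4 := pow_nonneg (Real.log_nonneg hN1) _
  calc ‖oddPrimeLogSum N α‖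
      ≤ C * (X ^ (1 - 3 * a) + X ^ (4 / 5 : ℝ) + X ^ (1 - 3 * a)) * Real.log X ^ 4 := h
    _ ≤ C * (X ^ (1 - 3 * a) + X ^ (4 / 5 : ℝ) + X ^ (1 - 3 * a)) * X ^ (δ / 8) :=
        mul_le_mul_of_nonneg_left hlogN (by positivity)
    _ = C * (2 * (X ^ (1 - 3 * a) * X ^ (δ / 8)) + X ^ (4 / 5 : ℝ) * X ^ (δ / 8)) := by ring
    _ ≤ C * (2 * X ^ (1 - 5 * δ / 8) + X ^ (1 - 5 * δ / 8)) := by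
        apply mul_le_mul_of_nonneg_left _ hC0; linarith
    _ = (3 * C) * X ^ (1 - 5 * δ / 8) := by ring
    _ ≤ X ^ (δ / 8) * X ^ (1 - 5 * δ / 8) := mul_le_mul_of_nonneg_right (by linarith) hY0
    _ = X ^ (1 - δ / 2) := by rw [hsplit, mul_comm]

/-! ### The exceptional prime at a level -/

/-- **The exceptional prime at level `P`**: there is `p ∈ {0} ∪ {primes > 3}` such that, when a
`c₁`-exceptional datum exists at level `P`, some datum `(r̃, χ̃, β̃)` has either no prime factor
`> 3` (and `p = 0`) or `p` = the largest prime factor `> 3` of `r̃`; and `p = 0` when there is no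
exceptional datum (the `p*` of Gallagher's treatment of the exceptional character; Montgomery–Vaughan
p. 368 use any prime `p > 3` of `r̃`). [cite: MontgomeryVaughanActa1975, §8 (8.5); Gallagher1975, §4] -/
theorem exists_excPrime (c₁ P : ℝ) :
    ∃ p : ℕ, (p = 0 ∨ (p.Prime ∧ 3 < p)) ∧
      ((∃ (r : ℕ) (_ : NeZero r) (χ : DirichletCharacter ℂ r) (β : ℝ), IsExceptionalZero c₁ P r χ β) →
        ∃ (r : ℕ) (_ : NeZero r) (χ : DirichletCharacter ℂ r) (β : ℝ), IsExceptionalZero c₁ P r χ β ∧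
          ((p = 0 ∧ ∀ q ∈ r.primeFactors, ¬ 3 < q) ∨
           (p ∈ r.primeFactors ∧ 3 < p ∧ ∀ q ∈ r.primeFactors, 3 < q → q ≤ p))) ∧
      ((¬ ∃ (r : ℕ) (_ : NeZero r) (χ : DirichletCharacter ℂ r) (β : ℝ), IsExceptionalZero c₁ P r χ β) →
        p = 0) := by
  by_cases h : ∃ (r : ℕ) (_ : NeZero r) (χ : DirichletCharacter ℂ r) (β : ℝ), IsExceptionalZero c₁ P r χ β
  · obtain ⟨r, hr, χ, β, hEZ⟩ := h
    set T := r.primeFactors.filter (fun q => 3 < q) with hT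
    by_cases hT0 : T.Nonempty
    · refine ⟨T.max' hT0, Or.inr ?_, fun _ => ⟨r, hr, χ, β, hEZ, Or.inr ?_⟩,
        fun hno => absurd ⟨r, hr, χ, β, hEZ⟩ hno⟩
      · have hm := Finset.max'_mem T hT0
        rw [Finset.mem_filter] at hm
        exact ⟨Nat.prime_of_mem_primeFactors hm.1, hm.2⟩
      · have hm := Finset.max'_mem T hT0
        rw [Finset.mem_filter] at hm
        exact ⟨hm.1, hm.2, fun q hq hq3 => Finset.le_max' T q (Finset.mem_filter.mpr ⟨hq, hq3⟩)⟩
    · refine ⟨0, Or.inl rfl, fun _ => ⟨r, hr, χ, β, hEZ, Or.inl ⟨rfl, fun q hq hq3 => ?_⟩⟩,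
        fun _ => rfl⟩
      exact hT0 ⟨q, Finset.mem_filter.mpr ⟨hq, hq3⟩⟩
  · exact ⟨0, Or.inl rfl, fun h' => absurd h' h, fun _ => rfl⟩

/-- From `r̃ ∣ 24 ∏_{q ∣ r̃, q>3} q` (`dvd_mul_prod_primeFactors_of_isPrimitive`): if every prime
`q > 3` of the conductor `r̃` of a primitive quadratic character is `< B`, then
`r̃ ≤ 24 · primorial B`. [cite: MontgomeryVaughan2007, Theorem 9.13] -/
theorem conductor_le_primorial_of_primeFactors_lt {r : ℕ} [NeZero r] {χ : DirichletCharacter ℂ r}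
    (hχ : χ.IsPrimitive) (h2 : χ ^ 2 = 1) {B : ℕ}
    (hB : ∀ q ∈ r.primeFactors, 3 < q → q < B) : r ≤ 24 * primorial B := by
  have hdvd := dvd_mul_prod_primeFactors_of_isPrimitive hχ h2
  have hsub : r.primeFactors.filter (3 < ·) ⊆ (Finset.range (B + 1)).filter Nat.Prime := by
    intro q hq
    rw [Finset.mem_filter] at hq ⊢
    exact ⟨Finset.mem_range.mpr (by have := hB q hq.1 hq.2; omega), Nat.prime_of_mem_primeFactors hq.1⟩
  have hdvd2 : 24 * ∏ p ∈ r.primeFactors.filter (3 < ·), p ∣ 24 * primorial B :=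
    mul_dvd_mul_left 24 (Finset.prod_dvd_prod_of_subset _ _ _ hsub)
  exact Nat.le_of_dvd (Nat.mul_pos (by norm_num) (primorial_pos B)) (hdvd.trans hdvd2)

/-! ### The per-level package -/

/-- **Everything at a fixed level `a ∈ [δ/4, δ]`, eventually in `N`**: the minor-arc bound
`‖A_N‖ ≤ N^{1−δ/2}` off `periodicArcs (N^{6a}) (N^{1−6a})`, Lemma 4.1 at `(c₁, N^{6a})`, every
exceptional conductor `> R`, and — GIVEN the level-selection property `r̃ ≤ P^{2/3}` at `(a, N)` —
the pointwise bounds of `pointwise_lowerBound_of_formulae` for all even `n ∈ [N/2, N]`.  Inputs: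
the major-arc formulae at `(c₁, a)` (`hFa`, from `majorArc_formulae_forall_small`), the choice of
`δ` (`hexp`, `hexp'`), `exceptionalConductor_unbounded`, `eventually_level_thresholds`,
`eventually_minorArc_level`. [cite: MontgomeryVaughanActa1975, §8 (8.3)–(8.6); Gallagher1975, §4] -/
theorem eventually_pointwise_level {c₁ c₆ C δ a κ : ℝ} (hc₁ : 0 < c₁) (hC : 0 < C) (hκ : 0 < κ)
    (hδ : 0 < δ) (hδ24 : δ ≤ 1 / 24) (ha : δ / 4 ≤ a) (haδ : a ≤ δ)
    (hFa : ∃ X₀ : ℝ, ∀ X : ℝ, X₀ ≤ X →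
      Lemma41At c₁ (X ^ (6 * a)) ∧
      (((∀ (r : ℕ) [NeZero r] (χ : DirichletCharacter ℂ r) (β : ℝ),
            ¬ IsExceptionalZero c₁ (X ^ (6 * a)) r χ β) →
        ∀ n : ℕ, 1 ≤ n → (n : ℝ) ≤ X →
          ‖majorArcIntegral (X ^ (6 * a)) (X ^ (1 - 6 * a)) X n - ((goldbachSingularSeries n * n : ℝ) : ℂ)‖ ≤
            C * (X ^ (1 + a) * (X ^ (6 * a))⁻¹ +
              (n : ℝ) / (Nat.totient n : ℝ) * X * Real.exp (-(c₆ / a))))) ∧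
      (∀ (r : ℕ) [NeZero r] (χ : DirichletCharacter ℂ r) (β : ℝ),
          IsExceptionalZero c₁ (X ^ (6 * a)) r χ β →
        ∀ n : ℕ, 1 ≤ n → (n : ℝ) ≤ X → Even n →
          ‖majorArcIntegral (X ^ (6 * a)) (X ^ (1 - 6 * a)) X n -
              ((goldbachSingularSeries n * (n + excRatio χ n * excPairSum (X ^ (6 * a)) X β n) : ℝ) : ℂ)‖ ≤
            C * ((if n.Coprime r then (r : ℝ) * n * X / ((Nat.totient r : ℝ) ^ 2 * Nat.totient n) else 0) +
              X ^ (1 + a) * (X ^ (6 * a))⁻¹ * Nat.gcd n r +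
              (n : ℝ) / (Nat.totient n : ℝ) * X * ((1 - β) * Real.log (X ^ (6 * a))) * Real.exp (-(c₆ / a)))))
    (hexp : C * Real.exp (-(c₆ / a)) ≤ κ / 4 * twinPrimeConst)
    (hexp' : C * (c₁ * Real.exp (-(c₆ / a))) ≤ κ / 4 * twinPrimeConst) (R : ℕ) :
    ∀ᶠ N : ℕ in atTop,
      (∀ α ∈ Set.Icc (0 : ℝ) 1 \ periodicArcs ((N : ℝ) ^ (6 * a)) ((N : ℝ) ^ (1 - 6 * a)),
          ‖oddPrimeLogSum N α‖ ≤ (N : ℝ) ^ (1 - δ / 2)) ∧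
      Lemma41At c₁ ((N : ℝ) ^ (6 * a)) ∧
      (∀ (r : ℕ) [NeZero r] (χ : DirichletCharacter ℂ r) (β : ℝ),
          IsExceptionalZero c₁ ((N : ℝ) ^ (6 * a)) r χ β → R < r ∧ 24 < r) ∧
      ((∀ (r : ℕ) [NeZero r] (χ : DirichletCharacter ℂ r) (β : ℝ),
          IsExceptionalZero c₁ ((N : ℝ) ^ (6 * a)) r χ β →
            (r : ℝ) ≤ ((N : ℝ) ^ (6 * a)) ^ (2 / 3 : ℝ)) →
        ∀ n : ℕ, Even n → N ≤ 2 * n → n ≤ N →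
          -(κ * (goldbachSingularSeries n * N)) ≤
              majorArcGoldbachIntegral (periodicArcs ((N : ℝ) ^ (6 * a)) ((N : ℝ) ^ (1 - 6 * a))) N n ∧
          ((∀ (r : ℕ) [NeZero r] (χ : DirichletCharacter ℂ r) (β : ℝ),
              IsExceptionalZero c₁ ((N : ℝ) ^ (6 * a)) r χ β → ∃ q ∈ r.primeFactors, 3 < q ∧ ¬ q ∣ n) →
            2 / 3 * (goldbachSingularSeries n * n) - κ * (goldbachSingularSeries n * N) ≤
              majorArcGoldbachIntegral
                (periodicArcs ((N : ℝ) ^ (6 * a)) ((N : ℝ) ^ (1 - 6 * a))) N n)) := by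
  have ha0 : 0 < a := by linarith
  have ha18 : a < 1 / 18 := by linarith
  have hC₂ : 0 < twinPrimeConst := lt_of_lt_of_le (by norm_num) half_le_twinPrimeConst
  obtain ⟨X₀, hX₀⟩ := hFa
  -- the conductor threshold: `R`, `24` and `24 (4C/(κ C₂))²`
  set R' : ℕ := max (max R 24) ⌈24 * (4 * C / (κ * twinPrimeConst)) ^ 2⌉₊ with hR'
  have hthr := (eventually_level_thresholds c₁ ha0 ha18 hC hκ).natCast_atTop
  have hcond := (eventually_conductor_gt_level hc₁ ha0 R').natCast_atTop
  have hform : ∀ᶠ N : ℕ in atTop, X₀ ≤ (N : ℝ) := (eventually_ge_atTop X₀).natCast_atTop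
  filter_upwards [eventually_minorArc_level hδ hδ24 ha haδ, hthr, hcond, hform]
    with N hminor hT hcN hNX₀
  obtain ⟨hP2, hPQ, hlogP, hT3, hT4, hT5⟩ := hT
  have hF := hX₀ (N : ℝ) hNX₀
  have hbigR : ∀ (r : ℕ) [NeZero r] (χ : DirichletCharacter ℂ r) (β : ℝ),
      IsExceptionalZero c₁ ((N : ℝ) ^ (6 * a)) r χ β → R < r ∧ 24 < r := by
    intro r _ χ β h
    have h' := hcN r χ β h
    have h1 : max R 24 ≤ R' := le_max_left _ _
    exact ⟨by omega, by omega⟩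
  have hbig : ∀ (r : ℕ) [NeZero r] (χ : DirichletCharacter ℂ r) (β : ℝ),
      IsExceptionalZero c₁ ((N : ℝ) ^ (6 * a)) r χ β →
        (24 : ℝ) < r ∧ 24 * (4 * C / (κ * twinPrimeConst)) ^ 2 < (r : ℝ) := by
    intro r _ χ β h
    have h' := hcN r χ β h
    have h24 : 24 < r := (hbigR r χ β h).2
    refine ⟨by exact_mod_cast h24, ?_⟩
    have h2 : ⌈24 * (4 * C / (κ * twinPrimeConst)) ^ 2⌉₊ ≤ R' := le_max_right _ _
    have h3 : (R' : ℝ) < r := by exact_mod_cast h'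
    exact lt_of_le_of_lt ((Nat.le_ceil _).trans (by exact_mod_cast h2)) h3
  exact ⟨hminor, hF.1, hbigR, fun hsel =>
    pointwise_lowerBound_of_formulae hc₁ hC hκ hP2 hPQ hlogP hF hsel hbig hT3 hT4 hT5 hexp hexp'⟩

/-! ### The crux `PointwiseMajorArcsMV` of route `LinnikGallagherMV`, verbatim -/

/-- **POINTWISE MAJOR ARCS WITH THE EXCEPTIONAL PRIME BUILT IN** — VERBATIM the crux
`PointwiseMajorArcsMV` of the parity-ideate route `LinnikGallagherMV` (stmt-Parity-20512): there is
`c₀ > 0` (here `2/3`) such that for every `κ > 0` there are `θ > 0` (`δ/2`), measurable sets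
`𝔐_N ⊂ ℝ` (the periodised Montgomery–Vaughan arcs at the Page-selected level
`P = N^{6a(N)}`, `a(N) ∈ {δ/4, 2δ/3, δ}`) and `p_N ∈ {0} ∪ {odd primes}` (the largest prime `> 3`
of the exceptional conductor at that level) with `p_N = 0` or `p_N → ∞`, such that eventually in
`N`: `|A_N(α)| ≤ N^{1−θ}` for `α ∈ [0,1] ∖ 𝔐_N`, and for every even `n` with `N/2 ≤ n ≤ N`,
`R_𝔐(n) ≥ −κ𝔖(n)N`, and `R_𝔐(n) ≥ c₀𝔖(n)n − κ𝔖(n)N` whenever `p_N ∤ n`.  This is the major-arc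
input of Gallagher's proof of Linnik's theorem [Gallagher1975, Theorem 1, §§3–4], obtained here
from Montgomery–Vaughan's major-arc analysis [MontgomeryVaughanActa1975, (4.3)–(4.6), (6.17),
(6.1͂7), (7.1), (7.͂1), §8] as PROVED in the tree.
[cite: Gallagher1975, Theorem 1 and §§3–4; MontgomeryVaughanActa1975, §§6–8] -/
theorem pointwiseMajorArcsMV :
    ∃ c₀ : ℝ, 0 < c₀ ∧ ∀ κ : ℝ, 0 < κ → ∃ θ : ℝ, 0 < θ ∧ ∃ 𝔐 : ℕ → Set ℝ,
      (∀ N, MeasurableSet (𝔐 N)) ∧ ∃ p : ℕ → ℕ, (∀ N, p N = 0 ∨ ((p N).Prime ∧ Odd (p N))) ∧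
      (∀ B : ℕ, ∀ᶠ N : ℕ in atTop, p N = 0 ∨ B ≤ p N) ∧
      (∀ᶠ N : ℕ in atTop, ∀ α ∈ Set.Icc (0 : ℝ) 1 \ 𝔐 N,
        ‖Literature.NumberTheory.Sieve.GoldbachLinnik.oddPrimeLogSum N α‖ ≤ (N : ℝ) ^ (1 - θ)) ∧
      (∀ᶠ N : ℕ in atTop, ∀ n : ℕ, Even n → N ≤ 2 * n → n ≤ N →
        -(κ * (Literature.NumberTheory.Sieve.goldbachSingularSeries n * N)) ≤
            Literature.NumberTheory.Sieve.GoldbachLinnik.majorArcGoldbachIntegral (𝔐 N) N n ∧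
        (¬ (p N ∣ n) →
          c₀ * (Literature.NumberTheory.Sieve.goldbachSingularSeries n * n) -
              κ * (Literature.NumberTheory.Sieve.goldbachSingularSeries n * N) ≤
            Literature.NumberTheory.Sieve.GoldbachLinnik.majorArcGoldbachIntegral (𝔐 N) N n)) := by
  -- ### constants: the Page constant `c₁`, then `c₆, C, δ₀` of the formulae
  obtain ⟨cF, hcF, HF⟩ := majorArc_formulae_forall_small
  obtain ⟨cL, hcL, HL⟩ := levelSelection
  set c₁ : ℝ := min cF cL / 2 with hc₁def
  have hc₁ : 0 < c₁ := by rw [hc₁def]; exact div_pos (lt_min hcF hcL) two_pos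
  have hc₁F : c₁ < cF := by
    have := min_le_left cF cL; rw [hc₁def]; linarith
  have hc₁L : c₁ < cL := by
    have := min_le_right cF cL; rw [hc₁def]; linarith
  obtain ⟨c₆, hc₆, C, hC, δ₀, hδ₀, HFδ⟩ := HF c₁ hc₁ hc₁F
  have hC₂ : 0 < twinPrimeConst := lt_of_lt_of_le (by norm_num) half_le_twinPrimeConst
  refine ⟨2 / 3, by norm_num, fun κ hκ => ?_⟩
  -- ### choice of `δ`: `C (1 + c₁) e^{-c₆/δ} ≤ κ C₂ / 4`, `δ ≤ δ₀`, `δ ≤ 1/24`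
  set η : ℝ := κ * twinPrimeConst / (4 * (C * (1 + c₁))) with hηdef
  have hη : 0 < η := by positivity
  set δ : ℝ := min (min δ₀ (1 / 24)) (c₆ / (1 + |Real.log η|)) with hδdef
  have hδ : 0 < δ := by
    rw [hδdef]; exact lt_min (lt_min hδ₀ (by norm_num)) (by positivity)
  have hδδ₀ : δ ≤ δ₀ := (min_le_left _ _).trans (min_le_left _ _)
  have hδ24 : δ ≤ 1 / 24 := (min_le_left _ _).trans (min_le_right _ _)
  have hexpδ : Real.exp (-(c₆ / δ)) ≤ η := by
    have hδle : δ ≤ c₆ / (1 + |Real.log η|) := min_le_right _ _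
    have h1 : 1 + |Real.log η| ≤ c₆ / δ := by
      rw [le_div_iff₀ hδ]
      have := (le_div_iff₀ (by positivity : (0 : ℝ) < 1 + |Real.log η|)).mp hδle
      linarith
    calc Real.exp (-(c₆ / δ)) ≤ Real.exp (Real.log η) := by
          apply Real.exp_le_exp.mpr
          have := neg_abs_le (Real.log η)
          linarith
      _ = η := Real.exp_log hη
  -- hence the two `e^{-c₆/a}` conditions at every level `a ≤ δ`
  have hexp_at : ∀ a : ℝ, 0 < a → a ≤ δ →
      C * Real.exp (-(c₆ / a)) ≤ κ / 4 * twinPrimeConst ∧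
      C * (c₁ * Real.exp (-(c₆ / a))) ≤ κ / 4 * twinPrimeConst := by
    intro a ha haδ
    have hea : Real.exp (-(c₆ / a)) ≤ η := by
      refine le_trans (Real.exp_le_exp.mpr ?_) hexpδ
      have : c₆ / δ ≤ c₆ / a := div_le_div_of_nonneg_left hc₆.le ha haδ
      linarith
    have hkey : C * (1 + c₁) * η = κ / 4 * twinPrimeConst := by
      rw [hηdef]; field_simp
    have he0 : 0 ≤ Real.exp (-(c₆ / a)) := (Real.exp_pos _).le
    constructor
    · calc C * Real.exp (-(c₆ / a)) ≤ C * (1 + c₁) * Real.exp (-(c₆ / a)) := by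
            have : 0 ≤ C * c₁ * Real.exp (-(c₆ / a)) := by positivity
            nlinarith
        _ ≤ C * (1 + c₁) * η := mul_le_mul_of_nonneg_left hea (by positivity)
        _ = κ / 4 * twinPrimeConst := hkey
    · calc C * (c₁ * Real.exp (-(c₆ / a))) ≤ C * (1 + c₁) * Real.exp (-(c₆ / a)) := by
            have : 0 ≤ C * Real.exp (-(c₆ / a)) := by positivity
            nlinarith
        _ ≤ C * (1 + c₁) * η := mul_le_mul_of_nonneg_left hea (by positivity)
        _ = κ / 4 * twinPrimeConst := hkey
  refine ⟨δ / 2, by positivity, ?_⟩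
  -- ### the selected level `a N ∈ {δ/4, 2δ/3, δ}`
  obtain ⟨X₀L, hX₀L⟩ := HL c₁ hc₁ hc₁L δ hδ
  obtain ⟨a, ha⟩ : ∃ a : ℕ → ℝ, ∀ N : ℕ, (a N = δ / 4 ∨ a N = 2 * δ / 3 ∨ a N = δ) ∧
      (X₀L ≤ (N : ℝ) → ∀ (r : ℕ) [NeZero r] (χ : DirichletCharacter ℂ r) (β : ℝ),
        IsExceptionalZero c₁ ((N : ℝ) ^ (6 * a N)) r χ β →
          (r : ℝ) ≤ ((N : ℝ) ^ (6 * a N)) ^ (2 / 3 : ℝ)) := by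
    refine ⟨fun N => if h : X₀L ≤ (N : ℝ) then Classical.choose (hX₀L N h) else δ, fun N => ?_⟩
    beta_reduce
    by_cases h : X₀L ≤ (N : ℝ)
    · rw [dif_pos h]
      exact ⟨(Classical.choose_spec (hX₀L N h)).1, fun _ => (Classical.choose_spec (hX₀L N h)).2⟩
    · rw [dif_neg h]
      exact ⟨Or.inr (Or.inr rfl), fun h' => absurd h' h⟩
  refine ⟨fun N => periodicArcs ((N : ℝ) ^ (6 * a N)) ((N : ℝ) ^ (1 - 6 * a N)),
    fun N => measurableSet_periodicArcs _ _, ?_⟩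
  -- ### the exceptional prime `p N` at the selected level
  obtain ⟨p, hp⟩ : ∃ p : ℕ → ℕ, ∀ N : ℕ,
      (p N = 0 ∨ ((p N).Prime ∧ 3 < p N)) ∧
      ((∃ (r : ℕ) (_ : NeZero r) (χ : DirichletCharacter ℂ r) (β : ℝ),
          IsExceptionalZero c₁ ((N : ℝ) ^ (6 * a N)) r χ β) →
        ∃ (r : ℕ) (_ : NeZero r) (χ : DirichletCharacter ℂ r) (β : ℝ),
          IsExceptionalZero c₁ ((N : ℝ) ^ (6 * a N)) r χ β ∧
          ((p N = 0 ∧ ∀ q ∈ r.primeFactors, ¬ 3 < q) ∨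
           (p N ∈ r.primeFactors ∧ 3 < p N ∧ ∀ q ∈ r.primeFactors, 3 < q → q ≤ p N))) ∧
      ((¬ ∃ (r : ℕ) (_ : NeZero r) (χ : DirichletCharacter ℂ r) (β : ℝ),
          IsExceptionalZero c₁ ((N : ℝ) ^ (6 * a N)) r χ β) → p N = 0) :=
    ⟨fun N => Classical.choose (exists_excPrime c₁ ((N : ℝ) ^ (6 * a N))),
      fun N => Classical.choose_spec (exists_excPrime c₁ ((N : ℝ) ^ (6 * a N)))⟩
  -- ### the per-level packages at the three levels
  have hlev : ∀ a' : ℝ, δ / 4 ≤ a' → a' ≤ δ → ∀ R : ℕ, ∀ᶠ N : ℕ in atTop,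
      (∀ α ∈ Set.Icc (0 : ℝ) 1 \ periodicArcs ((N : ℝ) ^ (6 * a')) ((N : ℝ) ^ (1 - 6 * a')),
          ‖oddPrimeLogSum N α‖ ≤ (N : ℝ) ^ (1 - δ / 2)) ∧
      Lemma41At c₁ ((N : ℝ) ^ (6 * a')) ∧
      (∀ (r : ℕ) [NeZero r] (χ : DirichletCharacter ℂ r) (β : ℝ),
          IsExceptionalZero c₁ ((N : ℝ) ^ (6 * a')) r χ β → R < r ∧ 24 < r) ∧
      ((∀ (r : ℕ) [NeZero r] (χ : DirichletCharacter ℂ r) (β : ℝ),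
          IsExceptionalZero c₁ ((N : ℝ) ^ (6 * a')) r χ β →
            (r : ℝ) ≤ ((N : ℝ) ^ (6 * a')) ^ (2 / 3 : ℝ)) →
        ∀ n : ℕ, Even n → N ≤ 2 * n → n ≤ N →
          -(κ * (goldbachSingularSeries n * N)) ≤
              majorArcGoldbachIntegral (periodicArcs ((N : ℝ) ^ (6 * a')) ((N : ℝ) ^ (1 - 6 * a'))) N n ∧
          ((∀ (r : ℕ) [NeZero r] (χ : DirichletCharacter ℂ r) (β : ℝ),
              IsExceptionalZero c₁ ((N : ℝ) ^ (6 * a')) r χ β → ∃ q ∈ r.primeFactors, 3 < q ∧ ¬ q ∣ n) →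
            2 / 3 * (goldbachSingularSeries n * n) - κ * (goldbachSingularSeries n * N) ≤
              majorArcGoldbachIntegral
                (periodicArcs ((N : ℝ) ^ (6 * a')) ((N : ℝ) ^ (1 - 6 * a'))) N n)) := by
    intro a' ha' ha'δ R
    have ha'0 : 0 < a' := by linarith
    obtain ⟨he, he'⟩ := hexp_at a' ha'0 ha'δ
    exact eventually_pointwise_level hc₁ hC hκ hδ hδ24 ha' ha'δ (HFδ a' ha'0 (ha'δ.trans hδδ₀))
      he he' R
  have hA : δ / 4 ≤ δ / 4 ∧ δ / 4 ≤ δ := ⟨le_rfl, by linarith⟩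
  have hB : δ / 4 ≤ 2 * δ / 3 ∧ 2 * δ / 3 ≤ δ := ⟨by linarith, by linarith⟩
  have hCc : δ / 4 ≤ δ ∧ δ ≤ δ := ⟨by linarith, le_rfl⟩
  have hX₀Lev : ∀ᶠ N : ℕ in atTop, X₀L ≤ (N : ℝ) := (eventually_ge_atTop X₀L).natCast_atTop
  -- from the `p`-specification and uniqueness: the «good `n`» property, and `p N → ∞`
  have hgood_of : ∀ N : ℕ, Lemma41At c₁ ((N : ℝ) ^ (6 * a N)) →
      (∀ (r : ℕ) [NeZero r] (χ : DirichletCharacter ℂ r) (β : ℝ),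
          IsExceptionalZero c₁ ((N : ℝ) ^ (6 * a N)) r χ β → 24 < r) →
      ∀ n : ℕ, ¬ p N ∣ n →
        ∀ (r : ℕ) [NeZero r] (χ : DirichletCharacter ℂ r) (β : ℝ),
          IsExceptionalZero c₁ ((N : ℝ) ^ (6 * a N)) r χ β → ∃ q ∈ r.primeFactors, 3 < q ∧ ¬ q ∣ n := by
    intro N h41 h24 n hpn r _ χ β hEZ
    obtain ⟨r₀, _, χ₀, β₀, hEZ₀, hcase⟩ := (hp N).2.1 ⟨r, ‹NeZero r›, χ, β, hEZ⟩
    have hrr : r = r₀ := (h41.2 r r₀ χ χ₀ β β₀ hEZ hEZ₀).1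
    rcases hcase with ⟨_, hnone⟩ | ⟨hmem, h3, _⟩
    · -- `r₀` has no prime `> 3`: `r₀ ≤ 24`, contradiction
      exfalso
      have hquad₀ : χ₀ ^ 2 = 1 := h41.1 r₀ χ₀ β₀ hEZ₀
      have hle : r₀ ≤ 24 * primorial 0 :=
        conductor_le_primorial_of_primeFactors_lt hEZ₀.1 hquad₀ fun q hq hq3 => absurd hq3 (hnone q hq)
      have := h24 r₀ χ₀ β₀ hEZ₀
      simp at hle
      omega
    · exact ⟨p N, hrr ▸ hmem, h3, hpn⟩
  have hbig_of : ∀ (B N : ℕ), Lemma41At c₁ ((N : ℝ) ^ (6 * a N)) →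
      (∀ (r : ℕ) [NeZero r] (χ : DirichletCharacter ℂ r) (β : ℝ),
          IsExceptionalZero c₁ ((N : ℝ) ^ (6 * a N)) r χ β → 24 * primorial B < r) →
      p N = 0 ∨ B ≤ p N := by
    intro B N h41 hR
    by_cases hp0 : p N = 0
    · exact Or.inl hp0
    right
    have hex : ∃ (r : ℕ) (_ : NeZero r) (χ : DirichletCharacter ℂ r) (β : ℝ),
        IsExceptionalZero c₁ ((N : ℝ) ^ (6 * a N)) r χ β := by
      by_contra hno
      exact hp0 ((hp N).2.2 hno)
    obtain ⟨r₀, _, χ₀, β₀, hEZ₀, hcase⟩ := (hp N).2.1 hex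
    rcases hcase with ⟨h0, _⟩ | ⟨_, _, hmax⟩
    · exact absurd h0 hp0
    · by_contra hlt
      push Not at hlt
      have hquad₀ : χ₀ ^ 2 = 1 := h41.1 r₀ χ₀ β₀ hEZ₀
      have hle : r₀ ≤ 24 * primorial B :=
        conductor_le_primorial_of_primeFactors_lt hEZ₀.1 hquad₀
          fun q hq hq3 => lt_of_le_of_lt (hmax q hq hq3) hlt
      have := hR r₀ χ₀ β₀ hEZ₀
      omega
  refine ⟨p, fun N => ?_, fun B => ?_, ?_, ?_⟩
  · -- `p N = 0 ∨ (prime ∧ odd)`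
    rcases (hp N).1 with h | ⟨hpr, h3⟩
    · exact Or.inl h
    · exact Or.inr ⟨hpr, hpr.odd_of_ne_two (by omega)⟩
  · -- `∀ B, ∀ᶠ N, p N = 0 ∨ B ≤ p N`
    filter_upwards [hlev _ hA.1 hA.2 (24 * primorial B), hlev _ hB.1 hB.2 (24 * primorial B),
      hlev _ hCc.1 hCc.2 (24 * primorial B)] with N h1 h2 h3
    rcases (ha N).1 with hN | hN | hN
    · refine hbig_of B N (hN ▸ h1.2.1) fun r _ χ β h => ?_
      rw [hN] at h; exact (h1.2.2.1 r χ β h).1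
    · refine hbig_of B N (hN ▸ h2.2.1) fun r _ χ β h => ?_
      rw [hN] at h; exact (h2.2.2.1 r χ β h).1
    · refine hbig_of B N (hN ▸ h3.2.1) fun r _ χ β h => ?_
      rw [hN] at h; exact (h3.2.2.1 r χ β h).1
  · -- minor arcs
    filter_upwards [hlev _ hA.1 hA.2 0, hlev _ hB.1 hB.2 0, hlev _ hCc.1 hCc.2 0] with N h1 h2 h3
    rcases (ha N).1 with hN | hN | hN <;> simp only [hN]
    · exact h1.1
    · exact h2.1
    · exact h3.1
  · -- the pointwise bounds at the selected level
    filter_upwards [hlev _ hA.1 hA.2 0, hlev _ hB.1 hB.2 0, hlev _ hCc.1 hCc.2 0, hX₀Lev]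
      with N h1 h2 h3 hNL n heven hNn hnN
    have hsel := (ha N).2 hNL
    have key : ∀ {a' : ℝ}, a N = a' →
        (Lemma41At c₁ ((N : ℝ) ^ (6 * a')) ∧
          (∀ (r : ℕ) [NeZero r] (χ : DirichletCharacter ℂ r) (β : ℝ),
              IsExceptionalZero c₁ ((N : ℝ) ^ (6 * a')) r χ β → 0 < r ∧ 24 < r) ∧
          ((∀ (r : ℕ) [NeZero r] (χ : DirichletCharacter ℂ r) (β : ℝ),
              IsExceptionalZero c₁ ((N : ℝ) ^ (6 * a')) r χ β →
                (r : ℝ) ≤ ((N : ℝ) ^ (6 * a')) ^ (2 / 3 : ℝ)) →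
            ∀ n : ℕ, Even n → N ≤ 2 * n → n ≤ N →
              -(κ * (goldbachSingularSeries n * N)) ≤
                  majorArcGoldbachIntegral
                    (periodicArcs ((N : ℝ) ^ (6 * a')) ((N : ℝ) ^ (1 - 6 * a'))) N n ∧
              ((∀ (r : ℕ) [NeZero r] (χ : DirichletCharacter ℂ r) (β : ℝ),
                  IsExceptionalZero c₁ ((N : ℝ) ^ (6 * a')) r χ β →
                    ∃ q ∈ r.primeFactors, 3 < q ∧ ¬ q ∣ n) →
                2 / 3 * (goldbachSingularSeries n * n) - κ * (goldbachSingularSeries n * N) ≤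
                  majorArcGoldbachIntegral
                    (periodicArcs ((N : ℝ) ^ (6 * a')) ((N : ℝ) ^ (1 - 6 * a'))) N n))) →
        -(κ * (goldbachSingularSeries n * N)) ≤
            majorArcGoldbachIntegral (periodicArcs ((N : ℝ) ^ (6 * a N)) ((N : ℝ) ^ (1 - 6 * a N))) N n ∧
          (¬ p N ∣ n → 2 / 3 * (goldbachSingularSeries n * n) - κ * (goldbachSingularSeries n * N) ≤
            majorArcGoldbachIntegral (periodicArcs ((N : ℝ) ^ (6 * a N)) ((N : ℝ) ^ (1 - 6 * a N))) N n) := by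
      intro a' hN hpack
      obtain ⟨h41, h24, hpw⟩ := hpack
      rw [hN] at hsel
      have hboth := hpw hsel n heven hNn hnN
      rw [hN]
      refine ⟨hboth.1, fun hpn => hboth.2 ?_⟩
      have h41' : Lemma41At c₁ ((N : ℝ) ^ (6 * a N)) := hN ▸ h41
      have h24' : ∀ (r : ℕ) [NeZero r] (χ : DirichletCharacter ℂ r) (β : ℝ),
          IsExceptionalZero c₁ ((N : ℝ) ^ (6 * a N)) r χ β → 24 < r := by
        intro r _ χ β h; rw [hN] at h; exact (h24 r χ β h).2
      have hg := hgood_of N h41' h24' n hpn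
      intro r _ χ β h
      exact hg r χ β (hN ▸ h)
    rcases (ha N).1 with hN | hN | hN
    · exact key hN ⟨h1.2.1, h1.2.2.1, h1.2.2.2⟩
    · exact key hN ⟨h2.2.1, h2.2.2.1, h2.2.2.2⟩
    · exact key hN ⟨h3.2.1, h3.2.2.1, h3.2.2.2⟩

end GoldbachLinnik

end Literature.NumberTheory.Sieve

end
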